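import Mathlib
import Summits.Ventures.PercRepro2.CutVertexPieceHarris2

/-!
# The cut vertex separating the roots, VIII: the atoms and the two BHK facts (blind cell PercRepro2,
p3 g2, 2026-08-25; `proofs/P3-BRIDGE.md` §10.9)

The pieces are polynomials in the probabilities of intersections of the five cluster events
`A = {a₁ ~ c}`, `O₁ = {o ∈ C(a₁)}`, `B₁ = {b ∈ C(a₁)}`, `O_c = {o ∈ C(c)}`, `B_c = {b ∈ C(c)}` — in the
CANONICAL form where `A ∩ O₁ = A ∩ O_c` and `A ∩ B₁ = A ∩ B_c` (`inter_a1c_a1o`, `inter_a1c_a1b`, the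
triple versions).  The certificates of P3-BRIDGE.md §10.9 use: Harris for pairs of these events
(`prob_mul_prob_le_prob_inter`), `bhk13_E` = BHK06 1.3 for `(B₁, O₁)` under `Q = Aᶜ`
(`bhk_same_cluster_events`), `bhk14_E` = BHK06 1.4 for `(O₁, B_c)` and `(B₁, O_c)` under `Q`
(`bhk_cross_cluster`), all written in the canonical atoms via `prob p (X ∩ Aᶜ) = prob p X − prob p (A ∩ X)`
(`prob_inter_compl_A`).  Own work; standard axioms.
-/

namespace Summit.Ventures.PercRepro2

open UnionCluster

namespace CovForm

namespace RootBridge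

section Atoms

open Classical

/-- `if b then 0 else 1 = 1 − if b then 1 else 0`. -/
lemma ite_zero_one_R {R : Type*} [Field R] (b : Bool) :
    (if b = true then (0 : R) else 1) = 1 - (if b = true then 1 else 0) := by
  cases b <;> simp

variable {V : Type*} {E : Type*} [Fintype E] [DecidableEq E] [Fintype V] [DecidableEq V] {R : Type*}
  [Field R] [LinearOrder R] [IsStrictOrderedRing R]
variable (p : E → R) (ends : E → Sym2 V) (o a₁ b c : V)

omit [Fintype E] [DecidableEq E] [Fintype V] [DecidableEq V] in
/-- `A ∩ O₁ = A ∩ O_c`. -/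
lemma inter_a1c_a1o : connEvent ends a₁ c ∩ connEvent ends a₁ o = connEvent ends a₁ c ∩ connEvent ends c o := by
  ext ω
  simp only [Set.mem_inter_iff, mem_connEvent]
  constructor
  · rintro ⟨h1, h2⟩; exact ⟨h1, conn_trans (conn_symm h1) h2⟩
  · rintro ⟨h1, h2⟩; exact ⟨h1, conn_trans h1 h2⟩

omit [Fintype E] [DecidableEq E] [Fintype V] [DecidableEq V] in
/-- `A ∩ B₁ = A ∩ B_c`. -/
lemma inter_a1c_a1b : connEvent ends a₁ c ∩ connEvent ends a₁ b = connEvent ends a₁ c ∩ connEvent ends c b := by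
  ext ω
  simp only [Set.mem_inter_iff, mem_connEvent]
  constructor
  · rintro ⟨h1, h2⟩; exact ⟨h1, conn_trans (conn_symm h1) h2⟩
  · rintro ⟨h1, h2⟩; exact ⟨h1, conn_trans h1 h2⟩

omit [Fintype E] [DecidableEq E] [Fintype V] [DecidableEq V] in
/-- `A ∩ B₁ ∩ O₁ = A ∩ B_c ∩ O_c`. -/
lemma inter_a1c_a1b_a1o : connEvent ends a₁ c ∩ connEvent ends a₁ b ∩ connEvent ends a₁ o =
    connEvent ends a₁ c ∩ connEvent ends c b ∩ connEvent ends c o := by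
  rw [inter_a1c_a1b, Set.inter_assoc, Set.inter_comm (connEvent ends c b), ← Set.inter_assoc,
    inter_a1c_a1o, Set.inter_assoc, Set.inter_comm (connEvent ends c o), ← Set.inter_assoc]

omit [Fintype E] [DecidableEq E] [Fintype V] [DecidableEq V] in
/-- `A ∩ B₁ ∩ O_c = A ∩ B_c ∩ O_c`. -/
lemma inter_a1c_a1b_co : connEvent ends a₁ c ∩ connEvent ends a₁ b ∩ connEvent ends c o =
    connEvent ends a₁ c ∩ connEvent ends c b ∩ connEvent ends c o := by
  rw [inter_a1c_a1b]

omit [Fintype E] [DecidableEq E] [Fintype V] [DecidableEq V] in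
/-- `A ∩ B_c ∩ O₁ = A ∩ B_c ∩ O_c`. -/
lemma inter_a1c_cb_a1o : connEvent ends a₁ c ∩ connEvent ends c b ∩ connEvent ends a₁ o =
    connEvent ends a₁ c ∩ connEvent ends c b ∩ connEvent ends c o := by
  rw [Set.inter_assoc, Set.inter_comm (connEvent ends c b), ← Set.inter_assoc, inter_a1c_a1o,
    Set.inter_assoc, Set.inter_comm (connEvent ends c o), ← Set.inter_assoc]

omit [Fintype V] [DecidableEq V] [LinearOrder R] [IsStrictOrderedRing R] in
/-- `P(X ∩ Aᶜ) = P(X) − P(A ∩ X)`. -/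
lemma prob_inter_compl_A (X : Set (Config E)) :
    prob p (X ∩ (connEvent ends a₁ c)ᶜ) = prob p X - prob p (connEvent ends a₁ c ∩ X) := by
  have h := prob_inter_add_prob_inter_compl p X (connEvent ends a₁ c)
  rw [Set.inter_comm X] at h
  linear_combination h

omit [Fintype V] [DecidableEq V] [LinearOrder R] [IsStrictOrderedRing R] in
/-- `P(Aᶜ) = 1 − P(A)`. -/
lemma prob_compl_A : prob p (connEvent ends a₁ c)ᶜ = 1 - prob p (connEvent ends a₁ c) := by
  have h := prob_inter_add_prob_inter_compl p Set.univ (connEvent ends a₁ c)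
  simp only [Set.univ_inter, prob_univ] at h
  linear_combination h

/-- **BHK 1.3 (same cluster) for `(B₁, O₁)` under `Q = Aᶜ`, in the canonical atoms.** -/
theorem bhk13_E (hp : IsProbVec p) :
    (prob p (connEvent ends a₁ b) - prob p (connEvent ends a₁ c ∩ connEvent ends c b)) *
        (prob p (connEvent ends a₁ o) - prob p (connEvent ends a₁ c ∩ connEvent ends c o)) ≤
      (prob p (connEvent ends a₁ b ∩ connEvent ends a₁ o) -
          prob p (connEvent ends a₁ c ∩ connEvent ends c b ∩ connEvent ends c o)) *
        (1 - prob p (connEvent ends a₁ c)) := by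
  have h := bhk_same_cluster_events p hp ends a₁ c (isUpperSet_mem_setOf b) (isUpperSet_mem_setOf o)
  rw [← connEvent_eq_clusterInEvent ends a₁ b, ← connEvent_eq_clusterInEvent ends a₁ o,
    prob_inter_compl_A, prob_inter_compl_A, prob_inter_compl_A, prob_compl_A,
    inter_a1c_a1b, inter_a1c_a1o, ← Set.inter_assoc, inter_a1c_a1b_a1o] at h
  exact h

/-- **BHK 1.4 (cross cluster) for `(O₁, B_c)` under `Q = Aᶜ`, in the canonical atoms.** -/
theorem bhk14_E_o1bc (hp : IsProbVec p) :
    (prob p (connEvent ends c b ∩ connEvent ends a₁ o) -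
          prob p (connEvent ends a₁ c ∩ connEvent ends c b ∩ connEvent ends c o)) *
        (1 - prob p (connEvent ends a₁ c)) ≤
      (prob p (connEvent ends a₁ o) - prob p (connEvent ends a₁ c ∩ connEvent ends c o)) *
        (prob p (connEvent ends c b) - prob p (connEvent ends a₁ c ∩ connEvent ends c b)) := by
  have h := bhk_cross_cluster p hp ends a₁ c (isUpperSet_mem_setOf o) (isUpperSet_mem_setOf b)
  rw [← connEvent_eq_clusterInEvent ends a₁ o, ← connEvent_eq_clusterInEvent ends c b,
    prob_inter_compl_A, prob_inter_compl_A, prob_inter_compl_A, prob_compl_A,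
    inter_a1c_a1o, Set.inter_comm (connEvent ends a₁ o), ← Set.inter_assoc, inter_a1c_cb_a1o] at h
  exact h

/-- **BHK 1.4 (cross cluster) for `(B₁, O_c)` under `Q = Aᶜ`, in the canonical atoms.** -/
theorem bhk14_E_b1oc (hp : IsProbVec p) :
    (prob p (connEvent ends a₁ b ∩ connEvent ends c o) -
          prob p (connEvent ends a₁ c ∩ connEvent ends c b ∩ connEvent ends c o)) *
        (1 - prob p (connEvent ends a₁ c)) ≤
      (prob p (connEvent ends a₁ b) - prob p (connEvent ends a₁ c ∩ connEvent ends c b)) *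
        (prob p (connEvent ends c o) - prob p (connEvent ends a₁ c ∩ connEvent ends c o)) := by
  have h := bhk_cross_cluster p hp ends a₁ c (isUpperSet_mem_setOf b) (isUpperSet_mem_setOf o)
  rw [← connEvent_eq_clusterInEvent ends a₁ b, ← connEvent_eq_clusterInEvent ends c o,
    prob_inter_compl_A, prob_inter_compl_A, prob_inter_compl_A, prob_compl_A,
    inter_a1c_a1b, ← Set.inter_assoc, inter_a1c_a1b_co] at h
  exact h

omit [Fintype V] [DecidableEq V] in
/-- `0 ≤ P(X) − P(A ∩ X)`. -/
lemma sub_prob_inter_nonneg (hp : IsProbVec p) (X : Set (Config E)) :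
    0 ≤ prob p X - prob p (connEvent ends a₁ c ∩ X) := by
  rw [← prob_inter_compl_A]
  exact prob_nonneg hp _

end Atoms

end RootBridge

end CovForm

end Summit.Ventures.PercRepro2
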